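/-
Copyright: the b2b-balaban T⁴-continuum CRUX team, row NE7b leaf lineage `t4-ne7b-formalise-leaf-03` (gen 149). Project licence.
-/
import Mathlib.Analysis.Calculus.MeanValue
import Summits.QuantumFields.BalabanUV.T4Continuum.Spine.NE7b.KKTChartDerivative
import Summits.QuantumFields.BalabanUV.T4Continuum.Spine.NE7b.HardStepBranchDerivModulus

/-!
# THE KKT CHART's DERIVATIVE HAS A MODULUS: `‖DΦ(δ, λ) − DΦ(δ′, λ′)‖ ≤ (2e₁ + M₃ + Λe₂ + C₂)·‖(δ, λ) − (δ′, λ′)‖` FROM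
# LIPSCHITZ LETTERS FOR `DG`, `D²V`, `D²G` AND THE SIZES OF `λ`, `D²G` — HENCE THE KKT BRANCH `w ↦ (δ(w), λ(w))` OF THE
# NONLINEAR-CONSTRAINT HARD STEP IS `C¹` WITH A LIPSCHITZ DERIVATIVE, CONSTANT `(N′⁻¹ − c)⁻³·(2e₁ + M₃ + Λe₂ + C₂)`
# (row NE7b, node U5c; the sequel of this lineage's `…KKTChartDerivative` (KCD) BY NAME, joined to leaf-04's
# `…HardStepBranchDerivModulus` (HSBDM) §2 BY NAME — the letter `…HardStepKKTBranch` (HKB) lists as NOT HERE «the modulus of `σ′`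
# (HSBDM's twin)»; [B11] CMP 102 p. 307 (182)–(190) «(δ∕δB)ℋ(B) … has regularity and decay properties identical to the propagator»;
# [folklore])

Cell `pub-balaban`, sub-cell `t4`, spine estimate NE7b (`T4WeightBudget.RelWeightBound`; the cell's OWN estimate — NOT PRINTED
in [Bałaban 1983–89], NOT PROVED).  Crux-route work under `Spine/NE7b/` by leaf-03 (CRUX team (2), FREEZE (0) crux-prover clause).
NOTHING of Bałaban's is named, asserted, valued or discharged; no `T4Continuum/Support` leaf typed; no `def`; zero `sorry`.  Imports:
KCD (the primal–dual map's derivative `hasFDerivAt_kktMap`, how it acts `kktDeriv_apply`, and the pointwise operator algebra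
`norm_kktDeriv_sub_kktOp_apply_le` — BY NAME, nothing restated), HSBDM (§2 `norm_fderiv_sub_fderiv_le_mul_of_chart` ∕
`contDiffOn_one_of_chart` — BY NAME), Mathlib's mean value inequality.  HKB's CONCLUSIONS (the KKT branch `σ` on its ball, Lipschitz,
with the derivative letters `A_w = DΦ(σ w)`, `‖A_w⁻¹ z‖ ≤ (N′⁻¹ − c)⁻¹‖z‖`, `HasFDerivAt σ (A_w⁻¹ ∘ inl) w`) enter §4 as displayed
hypotheses in HKB's own binder shapes — letters in, letters out; HKB (pending in the gate's retry lane) is NOT imported.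

WHY.  The KKT side of the hard-step cell now reads: ALE (the KKT operator `𝒦` is an equivalence, `‖𝒦⁻¹‖ ≤ N′`), KCD (`DΦ` and the
smallness letter `‖DΦ − 𝒦‖ ≤ 2a + b + Λe + ρ‖C₀‖`), HKB (the branch `σ = (δ, λ)` on the ball of radius `(N′⁻¹ − c)r`, Lipschitz
`(N′⁻¹ − c)⁻¹`, `C¹` with `σ′(w) = A_w⁻¹ ∘ inl`), leaf-04's HKAH (the value side along the branch).  What the next storey (the Hessian
letters of the next action, HKAH §3: «`HasFDerivAt λ λ′ w` ⟹ …»; HSIS (c)'s twin) consumes and HKB lists as NOT HERE is a MODULUS for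
`σ′`: by HSBDM §2 (`‖σ′(w) − σ′(w′)‖ ≤ L²‖Φ′(σ w) − Φ′(σ w′)‖`, resolvent identity) it is the modulus of the chart's derivative
`x ↦ DΦ(x)` along the branch, and for the primal–dual map `Φ(δ, λ) = (G δ, L δ − λ ∘ G′ δ)` that modulus is operator algebra over
the letters: `DΦ(δ, λ) − DΦ(δ′, λ′)` is KCD's defect operator `𝒟 − 𝒦` with `(A, T) := (G′δ, G′δ′)`, `(P, P₀) := (L′δ, L′δ′)`,
`(C, C₀) := (G″δ, G″δ′)`, `(λ, λ₀) := (λ, λ′)`, so KCD §3 bounds it by `2‖G′δ − G′δ′‖ + ‖L′δ − L′δ′‖ + ‖λ‖‖G″δ − G″δ′‖ + ‖λ − λ′‖‖G″δ′‖`,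
and Lipschitz letters `e₁` (for `G′`), `M₃` (for `L′ = D²V`), `e₂` (for `G″`) with the sizes `‖λ‖ ≤ Λ`, `‖G″‖ ≤ C₂` on the primal–dual
ball give the constant `2e₁ + M₃ + Λe₂ + C₂` (sup norm on `E × (F →L ℝ)`: both `‖δ − δ′‖` and `‖λ − λ′‖` are `≤ ‖x − x′‖`).  The
letter `e₁` is itself supplied from `C₂` by the mean value inequality (§3), so three letters `M₃, e₂, C₂` and the size `Λ` suffice.

WHAT IS PROVED ([folklore]; operator-norm bookkeeping, the mean value inequality — Mathlib
`Convex.norm_image_sub_le_of_norm_hasFDerivWithin_le` — and the second resolvent identity through HSBDM; nothing cited as a fact).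
`E`, `F` real normed spaces; `Φ y := (G y.1, L y.1 − y.2.comp (G′ y.1))` on `E × (F →L[ℝ] ℝ)` (written out, as in KCD ∕ HKB).
* §1 **`norm_fderiv_kktMap_sub_fderiv_kktMap_le`** — at two primal–dual points carrying KCD's three `HasFDerivAt` letters:
  `‖DΦ x − DΦ x′‖ ≤ 2‖G′x.1 − G′x′.1‖ + ‖L′x.1 − L′x′.1‖ + (‖x.2‖‖G″x.1 − G″x′.1‖ + ‖x.2 − x′.2‖‖G″x′.1‖)` (KCD BY NAME).
* §2 **`norm_fderiv_kktMap_sub_fderiv_kktMap_le_mul`** — on a set `s` with the Lipschitz letters `e₁, M₃, e₂ ≥ 0` (first coordinate)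
  and the sizes `‖x.2‖ ≤ Λ`, `‖G″x.1‖ ≤ C₂`: `‖DΦ x − DΦ x′‖ ≤ (2e₁ + M₃ + Λe₂ + C₂)‖x − x′‖` for `x, x′ ∈ s`;
  `continuousOn_fderiv_kktMap` (hence `DΦ` continuous on `s`).
* §3 THE MEAN-VALUE SUPPLIER on a primal–dual ball `closedBall x₀ r` (sup norm: its first shadow is the convex ball `closedBall x₀.1 r`):
  **`norm_sub_le_of_norm_deriv_le_fst`** — `HasFDerivAt G′ (G″x.1) x.1` and `‖G″x.1‖ ≤ C₂` for `x` in the ball ⟹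
  `‖G′x.1 − G′x′.1‖ ≤ C₂‖x.1 − x′.1‖` (so `e₁ := C₂`; the same lemma serves `L′` from a third-derivative letter and `G″` from `D³G`).
* §4 THE END, HKB's letters in — **`norm_fderiv_kktBranch_sub_le`**: HKB `exists_kktBranch_hasFDerivAt`'s conclusions on
  `closedBall w₀ ρ` ∕ `ball w₀ ρ`, `ρ := (N′⁻¹ − c)r` (ball membership triple, `LipschitzOnWith (N′⁻¹ − c)⁻¹`, the four-part derivative
  letter) + §2's letters on `closedBall x₀ r` ⟹ for `w, w′ ∈ ball w₀ ρ`,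
  `‖σ′(w) − σ′(w′)‖ ≤ ((N′⁻¹ − c)⁻¹)²·(2e₁ + M₃ + Λe₂ + C₂)·(N′⁻¹ − c)⁻¹·‖w − w′‖`; **`contDiffOn_one_kktBranch`**: `ContDiffOn ℝ 1 σ (ball w₀ ρ)`
  (HSBDM §2 BY NAME, `Φ′ := DΦ`, `L := (N′⁻¹ − c)⁻¹`).
* §5 toy (`example`): constant letters (`G′ ≡ T`, `G″ ≡ 0`, `L′ ≡ P`) — the modulus is `‖λ − λ′‖·0`, i.e. `DΦ` is locally constant
  up to the multiplier term, and §1 returns `≤ 0 + 0 + (‖λ‖·0 + ‖λ − λ′‖·0)`.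

NOT HERE (honest): the moduli `M₃, e₂` from third-derivative letters of `V`, `G` BY VALUE and which `V, G, δ₀, λ₀` are Bałaban's
((A3) ∕ (A1c), NC-NE7b-α UNRULED); the next action's Hessian letters along the KKT branch (HKAH §3–§5 consume `σ′`'s modulus — the
KKT twin of HSIS (c), an assembly for a later file); `C²` ∕ analyticity of `σ` with constants; anything of Bałaban's.  BY-NAME EFFECT ON
THE WALL: NONE.  NE7b NOT PRINTED ∕ NOT PROVED; spine PROVED 0∕9; rung (B)+1 on a FINITE torus — NOT infinite volume, NOT the mass gap,
NOT Clay.  HONEST DEPENDENCY: continuum YM on T⁴ ⇐ BetaPertH ∧ nine spine estimates (0/9 proved); BetaPertH ⇐ (D1) ∧ (D4) ∧ CAP+tail;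
G-an2-4 gates asym, D1 and NE2∕3∕4.
-/

set_option autoImplicit false

noncomputable section

namespace Summit.QuantumFields.BalabanUV.T4Continuum.NE7b.KKTChartDerivativeModulus

open Set Metric
open scoped NNReal
open Summit.QuantumFields.BalabanUV.T4Continuum.NE7b.KKTChartDerivative
  (hasFDerivAt_kktMap kktDeriv_apply norm_kktDeriv_sub_kktOp_apply_le)
open Summit.QuantumFields.BalabanUV.T4Continuum.NE7b.HardStepBranchDerivModulus
  (norm_fderiv_sub_fderiv_le_mul_of_chart contDiffOn_one_of_chart)

variable {E F : Type*} [NormedAddCommGroup E] [NormedSpace ℝ E] [NormedAddCommGroup F] [NormedSpace ℝ F]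

/-! ## §1. Two KKT derivatives differ by the moduli of their letters (KCD §3 by name) -/

/-- **THE DIFFERENCE OF TWO KKT DERIVATIVES IS KCD's DEFECT OPERATOR**: at primal–dual points `x = (δ, λ)`, `x′ = (δ′, λ′)` carrying
the three `HasFDerivAt` letters, `‖DΦ x − DΦ x′‖ ≤ 2‖G′δ − G′δ′‖ + ‖L′δ − L′δ′‖ + (‖λ‖‖G″δ − G″δ′‖ + ‖λ − λ′‖‖G″δ′‖)` (sup norms).
[folklore] -/
theorem norm_fderiv_kktMap_sub_fderiv_kktMap_le {G : E → F} {G' : E → E →L[ℝ] F} {G'' : E → E →L[ℝ] E →L[ℝ] F}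
    {L : E → E →L[ℝ] ℝ} {L' : E → E →L[ℝ] E →L[ℝ] ℝ} {x x' : E × (F →L[ℝ] ℝ)}
    (hG : HasFDerivAt G (G' x.1) x.1) (hG' : HasFDerivAt G' (G'' x.1) x.1) (hL : HasFDerivAt L (L' x.1) x.1)
    (hGx : HasFDerivAt G (G' x'.1) x'.1) (hG'x : HasFDerivAt G' (G'' x'.1) x'.1) (hLx : HasFDerivAt L (L' x'.1) x'.1) :
    ‖fderiv ℝ (fun y : E × (F →L[ℝ] ℝ) => (G y.1, L y.1 - y.2.comp (G' y.1))) x -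
        fderiv ℝ (fun y : E × (F →L[ℝ] ℝ) => (G y.1, L y.1 - y.2.comp (G' y.1))) x'‖ ≤
      2 * ‖G' x.1 - G' x'.1‖ + ‖L' x.1 - L' x'.1‖ + (‖x.2‖ * ‖G'' x.1 - G'' x'.1‖ + ‖x.2 - x'.2‖ * ‖G'' x'.1‖) := by
  obtain ⟨δ, lam⟩ := x
  obtain ⟨δ', lam'⟩ := x'
  rw [(hasFDerivAt_kktMap hG hG' hL).fderiv, (hasFDerivAt_kktMap hGx hG'x hLx).fderiv]
  refine ContinuousLinearMap.opNorm_le_bound _ (by positivity) fun q => ?_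
  obtain ⟨h, μ⟩ := q
  rw [sub_apply, kktDeriv_apply, kktDeriv_apply]
  exact norm_kktDeriv_sub_kktOp_apply_le (G' δ) (G' δ') (L' δ) (L' δ') (G'' δ) (G'' δ') lam lam' h μ

/-! ## §2. The Lipschitz modulus of `DΦ` from Lipschitz letters and sizes -/

/-- **THE MODULUS OF THE KKT CHART's DERIVATIVE.**  On a set `s` of primal–dual points with KCD's three `HasFDerivAt` letters, the
Lipschitz letters `‖G′x.1 − G′x′.1‖ ≤ e₁‖x.1 − x′.1‖`, `‖L′x.1 − L′x′.1‖ ≤ M₃‖x.1 − x′.1‖`, `‖G″x.1 − G″x′.1‖ ≤ e₂‖x.1 − x′.1‖`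
(`e₁, M₃, e₂ ≥ 0`) and the sizes `‖x.2‖ ≤ Λ`, `‖G″x.1‖ ≤ C₂`:
`‖DΦ x − DΦ x′‖ ≤ (2e₁ + M₃ + Λe₂ + C₂)·‖x − x′‖` for all `x, x′ ∈ s`. [folklore] -/
theorem norm_fderiv_kktMap_sub_fderiv_kktMap_le_mul {G : E → F} {G' : E → E →L[ℝ] F} {G'' : E → E →L[ℝ] E →L[ℝ] F}
    {L : E → E →L[ℝ] ℝ} {L' : E → E →L[ℝ] E →L[ℝ] ℝ} {s : Set (E × (F →L[ℝ] ℝ))} {e₁ M₃ e₂ Λ C₂ : ℝ}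
    (he₁ : 0 ≤ e₁) (hM₃ : 0 ≤ M₃) (he₂ : 0 ≤ e₂)
    (hG : ∀ x ∈ s, HasFDerivAt G (G' x.1) x.1) (hG' : ∀ x ∈ s, HasFDerivAt G' (G'' x.1) x.1)
    (hL : ∀ x ∈ s, HasFDerivAt L (L' x.1) x.1)
    (hlipG' : ∀ x ∈ s, ∀ x' ∈ s, ‖G' x.1 - G' x'.1‖ ≤ e₁ * ‖x.1 - x'.1‖)
    (hlipL' : ∀ x ∈ s, ∀ x' ∈ s, ‖L' x.1 - L' x'.1‖ ≤ M₃ * ‖x.1 - x'.1‖)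
    (hlipG'' : ∀ x ∈ s, ∀ x' ∈ s, ‖G'' x.1 - G'' x'.1‖ ≤ e₂ * ‖x.1 - x'.1‖)
    (hΛ : ∀ x ∈ s, ‖x.2‖ ≤ Λ) (hC₂ : ∀ x ∈ s, ‖G'' x.1‖ ≤ C₂) :
    ∀ x ∈ s, ∀ x' ∈ s,
      ‖fderiv ℝ (fun y : E × (F →L[ℝ] ℝ) => (G y.1, L y.1 - y.2.comp (G' y.1))) x -
          fderiv ℝ (fun y : E × (F →L[ℝ] ℝ) => (G y.1, L y.1 - y.2.comp (G' y.1))) x'‖ ≤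
        (2 * e₁ + M₃ + Λ * e₂ + C₂) * ‖x - x'‖ := by
  intro x hx x' hx'
  have h1 : ‖x.1 - x'.1‖ ≤ ‖x - x'‖ := by simpa using norm_fst_le (x - x')
  have h2 : ‖x.2 - x'.2‖ ≤ ‖x - x'‖ := by simpa using norm_snd_le (x - x')
  have hΛ0 : 0 ≤ Λ := (norm_nonneg _).trans (hΛ x hx)
  have hd : 0 ≤ ‖x - x'‖ := norm_nonneg _
  have hA : ‖G' x.1 - G' x'.1‖ ≤ e₁ * ‖x - x'‖ :=
    (hlipG' x hx x' hx').trans (mul_le_mul_of_nonneg_left h1 he₁)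
  have hP : ‖L' x.1 - L' x'.1‖ ≤ M₃ * ‖x - x'‖ :=
    (hlipL' x hx x' hx').trans (mul_le_mul_of_nonneg_left h1 hM₃)
  have hC : ‖x.2‖ * ‖G'' x.1 - G'' x'.1‖ ≤ Λ * (e₂ * ‖x - x'‖) :=
    mul_le_mul (hΛ x hx) ((hlipG'' x hx x' hx').trans (mul_le_mul_of_nonneg_left h1 he₂))
      (norm_nonneg (G'' x.1 - G'' x'.1)) hΛ0
  have hD : ‖x.2 - x'.2‖ * ‖G'' x'.1‖ ≤ ‖x - x'‖ * C₂ :=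
    mul_le_mul h2 (hC₂ x' hx') (norm_nonneg (G'' x'.1)) hd
  refine (norm_fderiv_kktMap_sub_fderiv_kktMap_le (hG x hx) (hG' x hx) (hL x hx) (hG x' hx') (hG' x' hx')
    (hL x' hx')).trans ?_
  calc 2 * ‖G' x.1 - G' x'.1‖ + ‖L' x.1 - L' x'.1‖ + (‖x.2‖ * ‖G'' x.1 - G'' x'.1‖ + ‖x.2 - x'.2‖ * ‖G'' x'.1‖)
      ≤ 2 * (e₁ * ‖x - x'‖) + M₃ * ‖x - x'‖ + (Λ * (e₂ * ‖x - x'‖) + ‖x - x'‖ * C₂) := by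
        refine add_le_add (add_le_add ?_ hP) (add_le_add hC hD)
        exact mul_le_mul_of_nonneg_left hA zero_le_two
    _ = (2 * e₁ + M₃ + Λ * e₂ + C₂) * ‖x - x'‖ := by ring

/-- **`DΦ` IS CONTINUOUS ON `s`** under the letters of `norm_fderiv_kktMap_sub_fderiv_kktMap_le_mul` (a Lipschitz map is continuous).
[folklore] -/
theorem continuousOn_fderiv_kktMap {G : E → F} {G' : E → E →L[ℝ] F} {G'' : E → E →L[ℝ] E →L[ℝ] F}
    {L : E → E →L[ℝ] ℝ} {L' : E → E →L[ℝ] E →L[ℝ] ℝ} {s : Set (E × (F →L[ℝ] ℝ))} {e₁ M₃ e₂ Λ C₂ : ℝ}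
    (he₁ : 0 ≤ e₁) (hM₃ : 0 ≤ M₃) (he₂ : 0 ≤ e₂)
    (hG : ∀ x ∈ s, HasFDerivAt G (G' x.1) x.1) (hG' : ∀ x ∈ s, HasFDerivAt G' (G'' x.1) x.1)
    (hL : ∀ x ∈ s, HasFDerivAt L (L' x.1) x.1)
    (hlipG' : ∀ x ∈ s, ∀ x' ∈ s, ‖G' x.1 - G' x'.1‖ ≤ e₁ * ‖x.1 - x'.1‖)
    (hlipL' : ∀ x ∈ s, ∀ x' ∈ s, ‖L' x.1 - L' x'.1‖ ≤ M₃ * ‖x.1 - x'.1‖)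
    (hlipG'' : ∀ x ∈ s, ∀ x' ∈ s, ‖G'' x.1 - G'' x'.1‖ ≤ e₂ * ‖x.1 - x'.1‖)
    (hΛ : ∀ x ∈ s, ‖x.2‖ ≤ Λ) (hC₂ : ∀ x ∈ s, ‖G'' x.1‖ ≤ C₂) :
    ContinuousOn (fun x => fderiv ℝ (fun y : E × (F →L[ℝ] ℝ) => (G y.1, L y.1 - y.2.comp (G' y.1))) x) s := by
  have hmod := norm_fderiv_kktMap_sub_fderiv_kktMap_le_mul he₁ hM₃ he₂ hG hG' hL hlipG' hlipL' hlipG'' hΛ hC₂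
  -- a map with a Lipschitz bound on `s` is Lipschitz on `s` (constant `(2e₁ + M₃ + Λe₂ + C₂).toNNReal`), hence continuous there
  have hlip : LipschitzOnWith (Real.toNNReal (2 * e₁ + M₃ + Λ * e₂ + C₂))
      (fun x => fderiv ℝ (fun y : E × (F →L[ℝ] ℝ) => (G y.1, L y.1 - y.2.comp (G' y.1))) x) s :=
    LipschitzOnWith.of_dist_le_mul fun x hx x' hx' => by
      simp only [dist_eq_norm]
      exact (hmod x hx x' hx').trans (mul_le_mul_of_nonneg_right (Real.le_coe_toNNReal _) (norm_nonneg (x - x')))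
  exact hlip.continuousOn

/-! ## §3. The mean-value supplier on a primal–dual ball -/

/-- **A LIPSCHITZ LETTER FROM A DERIVATIVE BOUND, FIRST COORDINATE OF A PRIMAL–DUAL BALL.**  For any map `f : E → H` with
`HasFDerivAt f (f′ x.1) x.1` and `‖f′ x.1‖ ≤ C` for every `x ∈ closedBall x₀ r` (sup norm on `E × (F →L ℝ)`):
`‖f x.1 − f x′.1‖ ≤ C‖x.1 − x′.1‖` for all `x, x′` in the ball — the mean value inequality on the convex shadow `closedBall x₀.1 r`
(use: `f := G′, f′ := G″, C := C₂` gives `e₁ := C₂`; `f := L′ = D²V` with a third-derivative letter gives `M₃`; `f := G″` gives `e₂`).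
[folklore] -/
theorem norm_sub_le_of_norm_deriv_le_fst {H : Type*} [NormedAddCommGroup H] [NormedSpace ℝ H]
    {f : E → H} {f' : E → E →L[ℝ] H} {x₀ : E × (F →L[ℝ] ℝ)} {r C : ℝ}
    (hf : ∀ x ∈ closedBall x₀ r, HasFDerivAt f (f' x.1) x.1) (hC : ∀ x ∈ closedBall x₀ r, ‖f' x.1‖ ≤ C) :
    ∀ x ∈ closedBall x₀ r, ∀ x' ∈ closedBall x₀ r, ‖f x.1 - f x'.1‖ ≤ C * ‖x.1 - x'.1‖ := by
  intro x hx x' hx'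
  -- every point of the shadow ball lifts into the primal–dual ball with second coordinate `x₀.2`
  have hlift : ∀ δ ∈ closedBall x₀.1 r, ((δ, x₀.2) : E × (F →L[ℝ] ℝ)) ∈ closedBall x₀ r := fun δ hδ => by
    rw [mem_closedBall, dist_eq_norm] at hδ ⊢
    have hr : 0 ≤ r := (norm_nonneg _).trans hδ
    rw [Prod.norm_def]
    refine max_le ?_ ?_
    · simpa using hδ
    · simpa using hr
  have hf1 : ∀ δ ∈ closedBall x₀.1 r, HasFDerivWithinAt f (f' δ) (closedBall x₀.1 r) δ := fun δ hδ =>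
    (hf (δ, x₀.2) (hlift δ hδ)).hasFDerivWithinAt
  have hC1 : ∀ δ ∈ closedBall x₀.1 r, ‖f' δ‖ ≤ C := fun δ hδ => hC (δ, x₀.2) (hlift δ hδ)
  have hx1 : x.1 ∈ closedBall x₀.1 r := by
    rw [mem_closedBall, dist_eq_norm] at hx ⊢
    exact (norm_fst_le _).trans (by simpa using hx)
  have hx'1 : x'.1 ∈ closedBall x₀.1 r := by
    rw [mem_closedBall, dist_eq_norm] at hx' ⊢
    exact (norm_fst_le _).trans (by simpa using hx')
  exact (convex_closedBall x₀.1 r).norm_image_sub_le_of_norm_hasFDerivWithin_le hf1 hC1 hx'1 hx1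

/-! ## §4. THE END: the KKT branch has a Lipschitz derivative (HSBDM §2 by name, HKB's letters in) -/

section Branch

/-- **THE KKT BRANCH's DERIVATIVE IS LIPSCHITZ WITH CONSTANT `((N′⁻¹ − c)⁻¹)²·(2e₁ + M₃ + Λe₂ + C₂)·(N′⁻¹ − c)⁻¹`.**
Letters in: on the primal–dual ball `closedBall x₀ r` KCD's three `HasFDerivAt` letters, the Lipschitz letters `e₁, M₃, e₂ ≥ 0` and the
sizes `Λ, C₂` of §2; `c < N′⁻¹`; and HKB `exists_kktBranch_hasFDerivAt`'s CONCLUSIONS for a map `σ : F → E × (F →L ℝ)` on the balls of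
radius `ρ := (N′⁻¹ − c)·r` about `w₀` VERBATIM — the membership triple on `closedBall w₀ ρ`, `LipschitzOnWith (N′⁻¹ − c)⁻¹ σ (closedBall w₀ ρ)`,
and for `w ∈ ball w₀ ρ` an equivalence `A` with `A = DΦ(σ w)`, `‖A⁻¹ z‖ ≤ (N′⁻¹ − c)⁻¹‖z‖`, `HasFDerivAt σ (A⁻¹ ∘ inl) w`, `‖A⁻¹ ∘ inl‖ ≤ (N′⁻¹ − c)⁻¹`.
Out: `‖σ′(w) − σ′(w′)‖ ≤ ((N′⁻¹ − c)⁻¹)²·(2e₁ + M₃ + Λe₂ + C₂)·(N′⁻¹ − c)⁻¹·‖w − w′‖` on `ball w₀ ρ`. [folklore] -/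
theorem norm_fderiv_kktBranch_sub_le {G : E → F} {G' : E → E →L[ℝ] F} {G'' : E → E →L[ℝ] E →L[ℝ] F}
    {L : E → E →L[ℝ] ℝ} {L' : E → E →L[ℝ] E →L[ℝ] ℝ} {x₀ : E × (F →L[ℝ] ℝ)} {r : ℝ} {e₁ M₃ e₂ Λ C₂ : ℝ}
    (he₁ : 0 ≤ e₁) (hM₃ : 0 ≤ M₃) (he₂ : 0 ≤ e₂)
    (hG : ∀ x ∈ closedBall x₀ r, HasFDerivAt G (G' x.1) x.1) (hG' : ∀ x ∈ closedBall x₀ r, HasFDerivAt G' (G'' x.1) x.1)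
    (hL : ∀ x ∈ closedBall x₀ r, HasFDerivAt L (L' x.1) x.1)
    (hlipG' : ∀ x ∈ closedBall x₀ r, ∀ x' ∈ closedBall x₀ r, ‖G' x.1 - G' x'.1‖ ≤ e₁ * ‖x.1 - x'.1‖)
    (hlipL' : ∀ x ∈ closedBall x₀ r, ∀ x' ∈ closedBall x₀ r, ‖L' x.1 - L' x'.1‖ ≤ M₃ * ‖x.1 - x'.1‖)
    (hlipG'' : ∀ x ∈ closedBall x₀ r, ∀ x' ∈ closedBall x₀ r, ‖G'' x.1 - G'' x'.1‖ ≤ e₂ * ‖x.1 - x'.1‖)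
    (hΛ : ∀ x ∈ closedBall x₀ r, ‖x.2‖ ≤ Λ) (hC₂ : ∀ x ∈ closedBall x₀ r, ‖G'' x.1‖ ≤ C₂)
    {N' c : ℝ≥0} (hc : c < N'⁻¹) {σ : F → E × (F →L[ℝ] ℝ)} {w₀ : F}
    (hσ : ∀ w ∈ closedBall w₀ (((N' : ℝ)⁻¹ - c) * r),
      σ w ∈ closedBall x₀ r ∧
        (G (σ w).1, L (σ w).1 - (σ w).2.comp (G' (σ w).1)).1 = w ∧
        (G (σ w).1, L (σ w).1 - (σ w).2.comp (G' (σ w).1)).2 = (G x₀.1, L x₀.1 - x₀.2.comp (G' x₀.1)).2)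
    (hlip : LipschitzOnWith (N'⁻¹ - c)⁻¹ σ (closedBall w₀ (((N' : ℝ)⁻¹ - c) * r)))
    (hσ' : ∀ w ∈ ball w₀ (((N' : ℝ)⁻¹ - c) * r),
      ∃ A : (E × (F →L[ℝ] ℝ)) ≃L[ℝ] (F × (E →L[ℝ] ℝ)),
        (A : (E × (F →L[ℝ] ℝ)) →L[ℝ] (F × (E →L[ℝ] ℝ))) =
            fderiv ℝ (fun y : E × (F →L[ℝ] ℝ) => (G y.1, L y.1 - y.2.comp (G' y.1))) (σ w) ∧
        (∀ z : F × (E →L[ℝ] ℝ), ‖A.symm z‖ ≤ ((N' : ℝ)⁻¹ - c)⁻¹ * ‖z‖) ∧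
        HasFDerivAt σ ((A.symm : (F × (E →L[ℝ] ℝ)) →L[ℝ] (E × (F →L[ℝ] ℝ))).comp
          (ContinuousLinearMap.inl ℝ F (E →L[ℝ] ℝ))) w ∧
        ‖(A.symm : (F × (E →L[ℝ] ℝ)) →L[ℝ] (E × (F →L[ℝ] ℝ))).comp (ContinuousLinearMap.inl ℝ F (E →L[ℝ] ℝ))‖ ≤
          ((N' : ℝ)⁻¹ - c)⁻¹) :
    ∀ w ∈ ball w₀ (((N' : ℝ)⁻¹ - c) * r), ∀ w' ∈ ball w₀ (((N' : ℝ)⁻¹ - c) * r),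
      ‖fderiv ℝ σ w - fderiv ℝ σ w'‖ ≤
        (((N' : ℝ)⁻¹ - c)⁻¹) ^ 2 * (2 * e₁ + M₃ + Λ * e₂ + C₂) * ((N' : ℝ)⁻¹ - c)⁻¹ * ‖w - w'‖ := by
  intro w hw w' hw'
  have hc' : (c : ℝ) < (N' : ℝ)⁻¹ := by
    have h := NNReal.coe_lt_coe.2 hc
    rwa [NNReal.coe_inv] at h
  have hK : (0 : ℝ) ≤ ((N' : ℝ)⁻¹ - c)⁻¹ := inv_nonneg.2 (sub_pos.2 hc').le
  have hcoe : (((N'⁻¹ - c)⁻¹ : ℝ≥0) : ℝ) = ((N' : ℝ)⁻¹ - c)⁻¹ := by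
    rw [NNReal.coe_inv, NNReal.coe_sub hc.le, NNReal.coe_inv]
  -- nonnegativity of the sizes (the open ball is nonempty, so the closed primal–dual ball is)
  have hx : σ w ∈ closedBall x₀ r := (hσ w (ball_subset_closedBall hw)).1
  have hΛ0 : 0 ≤ Λ := (norm_nonneg (σ w).2).trans (hΛ _ hx)
  have hC₂0 : 0 ≤ C₂ := (norm_nonneg (G'' (σ w).1)).trans (hC₂ _ hx)
  have hM : 0 ≤ 2 * e₁ + M₃ + Λ * e₂ + C₂ := by positivity
  -- the chart's modulus (§2) and HKB's letters in HSBDM §2's shapes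
  have hΦ'lip := norm_fderiv_kktMap_sub_fderiv_kktMap_le_mul he₁ hM₃ he₂ hG hG' hL hlipG' hlipL' hlipG'' hΛ hC₂
  have hσball : ∀ v ∈ ball w₀ (((N' : ℝ)⁻¹ - c) * r), σ v ∈ closedBall x₀ r := fun v hv =>
    (hσ v (ball_subset_closedBall hv)).1
  have hσlip : ∀ v ∈ ball w₀ (((N' : ℝ)⁻¹ - c) * r), ∀ v' ∈ ball w₀ (((N' : ℝ)⁻¹ - c) * r),
      ‖σ v - σ v'‖ ≤ ((N' : ℝ)⁻¹ - c)⁻¹ * ‖v - v'‖ := fun v hv v' hv' => by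
    have h := hlip.norm_sub_le (ball_subset_closedBall hv) (ball_subset_closedBall hv')
    rwa [hcoe] at h
  have hσ'' : ∀ v ∈ ball w₀ (((N' : ℝ)⁻¹ - c) * r),
      ∃ A : (E × (F →L[ℝ] ℝ)) ≃L[ℝ] (F × (E →L[ℝ] ℝ)),
        (A : (E × (F →L[ℝ] ℝ)) →L[ℝ] (F × (E →L[ℝ] ℝ))) =
            (fun x => fderiv ℝ (fun y : E × (F →L[ℝ] ℝ) => (G y.1, L y.1 - y.2.comp (G' y.1))) x) (σ v) ∧
        (∀ z : F × (E →L[ℝ] ℝ), ‖A.symm z‖ ≤ ((N' : ℝ)⁻¹ - c)⁻¹ * ‖z‖) ∧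
        HasFDerivAt σ ((A.symm : (F × (E →L[ℝ] ℝ)) →L[ℝ] (E × (F →L[ℝ] ℝ))).comp
          (ContinuousLinearMap.inl ℝ F (E →L[ℝ] ℝ))) v := fun v hv => by
    obtain ⟨A, h1, h2, h3, -⟩ := hσ' v hv
    exact ⟨A, h1, h2, h3⟩
  exact norm_fderiv_sub_fderiv_le_mul_of_chart hK hM hΦ'lip hσball hσlip hσ'' hw hw'

/-- **THE KKT BRANCH IS `C¹` ON THE OPEN CHART BALL** under the same letters: `ContDiffOn ℝ 1 σ (ball w₀ ((N′⁻¹ − c)r))`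
(HSBDM `contDiffOn_one_of_chart` by name; `DΦ` is continuous on the primal–dual ball by §2, `σ` by its Lipschitz letter). [folklore] -/
theorem contDiffOn_one_kktBranch {G : E → F} {G' : E → E →L[ℝ] F} {G'' : E → E →L[ℝ] E →L[ℝ] F}
    {L : E → E →L[ℝ] ℝ} {L' : E → E →L[ℝ] E →L[ℝ] ℝ} {x₀ : E × (F →L[ℝ] ℝ)} {r : ℝ} {e₁ M₃ e₂ Λ C₂ : ℝ}
    (he₁ : 0 ≤ e₁) (hM₃ : 0 ≤ M₃) (he₂ : 0 ≤ e₂)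
    (hG : ∀ x ∈ closedBall x₀ r, HasFDerivAt G (G' x.1) x.1) (hG' : ∀ x ∈ closedBall x₀ r, HasFDerivAt G' (G'' x.1) x.1)
    (hL : ∀ x ∈ closedBall x₀ r, HasFDerivAt L (L' x.1) x.1)
    (hlipG' : ∀ x ∈ closedBall x₀ r, ∀ x' ∈ closedBall x₀ r, ‖G' x.1 - G' x'.1‖ ≤ e₁ * ‖x.1 - x'.1‖)
    (hlipL' : ∀ x ∈ closedBall x₀ r, ∀ x' ∈ closedBall x₀ r, ‖L' x.1 - L' x'.1‖ ≤ M₃ * ‖x.1 - x'.1‖)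
    (hlipG'' : ∀ x ∈ closedBall x₀ r, ∀ x' ∈ closedBall x₀ r, ‖G'' x.1 - G'' x'.1‖ ≤ e₂ * ‖x.1 - x'.1‖)
    (hΛ : ∀ x ∈ closedBall x₀ r, ‖x.2‖ ≤ Λ) (hC₂ : ∀ x ∈ closedBall x₀ r, ‖G'' x.1‖ ≤ C₂)
    {N' c : ℝ≥0} (hc : c < N'⁻¹) {σ : F → E × (F →L[ℝ] ℝ)} {w₀ : F}
    (hσ : ∀ w ∈ closedBall w₀ (((N' : ℝ)⁻¹ - c) * r),
      σ w ∈ closedBall x₀ r ∧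
        (G (σ w).1, L (σ w).1 - (σ w).2.comp (G' (σ w).1)).1 = w ∧
        (G (σ w).1, L (σ w).1 - (σ w).2.comp (G' (σ w).1)).2 = (G x₀.1, L x₀.1 - x₀.2.comp (G' x₀.1)).2)
    (hlip : LipschitzOnWith (N'⁻¹ - c)⁻¹ σ (closedBall w₀ (((N' : ℝ)⁻¹ - c) * r)))
    (hσ' : ∀ w ∈ ball w₀ (((N' : ℝ)⁻¹ - c) * r),
      ∃ A : (E × (F →L[ℝ] ℝ)) ≃L[ℝ] (F × (E →L[ℝ] ℝ)),
        (A : (E × (F →L[ℝ] ℝ)) →L[ℝ] (F × (E →L[ℝ] ℝ))) =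
            fderiv ℝ (fun y : E × (F →L[ℝ] ℝ) => (G y.1, L y.1 - y.2.comp (G' y.1))) (σ w) ∧
        (∀ z : F × (E →L[ℝ] ℝ), ‖A.symm z‖ ≤ ((N' : ℝ)⁻¹ - c)⁻¹ * ‖z‖) ∧
        HasFDerivAt σ ((A.symm : (F × (E →L[ℝ] ℝ)) →L[ℝ] (E × (F →L[ℝ] ℝ))).comp
          (ContinuousLinearMap.inl ℝ F (E →L[ℝ] ℝ))) w ∧
        ‖(A.symm : (F × (E →L[ℝ] ℝ)) →L[ℝ] (E × (F →L[ℝ] ℝ))).comp (ContinuousLinearMap.inl ℝ F (E →L[ℝ] ℝ))‖ ≤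
          ((N' : ℝ)⁻¹ - c)⁻¹) :
    ContDiffOn ℝ 1 σ (ball w₀ (((N' : ℝ)⁻¹ - c) * r)) := by
  have hc' : (c : ℝ) < (N' : ℝ)⁻¹ := by
    have h := NNReal.coe_lt_coe.2 hc
    rwa [NNReal.coe_inv] at h
  have hK : (0 : ℝ) ≤ ((N' : ℝ)⁻¹ - c)⁻¹ := inv_nonneg.2 (sub_pos.2 hc').le
  have hΦ'c := continuousOn_fderiv_kktMap he₁ hM₃ he₂ hG hG' hL hlipG' hlipL' hlipG'' hΛ hC₂
  have hσball : ∀ v ∈ ball w₀ (((N' : ℝ)⁻¹ - c) * r), σ v ∈ closedBall x₀ r := fun v hv =>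
    (hσ v (ball_subset_closedBall hv)).1
  have hσc : ContinuousOn σ (ball w₀ (((N' : ℝ)⁻¹ - c) * r)) :=
    (hlip.mono ball_subset_closedBall).continuousOn
  have hσ'' : ∀ v ∈ ball w₀ (((N' : ℝ)⁻¹ - c) * r),
      ∃ A : (E × (F →L[ℝ] ℝ)) ≃L[ℝ] (F × (E →L[ℝ] ℝ)),
        (A : (E × (F →L[ℝ] ℝ)) →L[ℝ] (F × (E →L[ℝ] ℝ))) =
            (fun x => fderiv ℝ (fun y : E × (F →L[ℝ] ℝ) => (G y.1, L y.1 - y.2.comp (G' y.1))) x) (σ v) ∧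
        (∀ z : F × (E →L[ℝ] ℝ), ‖A.symm z‖ ≤ ((N' : ℝ)⁻¹ - c)⁻¹ * ‖z‖) ∧
        HasFDerivAt σ ((A.symm : (F × (E →L[ℝ] ℝ)) →L[ℝ] (E × (F →L[ℝ] ℝ))).comp
          (ContinuousLinearMap.inl ℝ F (E →L[ℝ] ℝ))) v := fun v hv => by
    obtain ⟨A, h1, h2, h3, -⟩ := hσ' v hv
    exact ⟨A, h1, h2, h3⟩
  exact contDiffOn_one_of_chart isOpen_ball hK hΦ'c hσball hσc hσ''

end Branch

/-! ## §5. Toy -/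

/-- Toy: CONSTANT letters `G′ ≡ T`, `G″ ≡ 0`, `L′ ≡ P` (an affine constraint and a quadratic action): two KKT derivatives differ
only through the multiplier term, and §1 returns `≤ 2·0 + 0 + (‖λ‖·0 + ‖λ − λ′‖·0)`. [folklore] -/
example {G : E → F} {L : E → E →L[ℝ] ℝ} (T : E →L[ℝ] F) (P : E →L[ℝ] E →L[ℝ] ℝ) {x x' : E × (F →L[ℝ] ℝ)}
    (hG : HasFDerivAt G T x.1) (hL : HasFDerivAt L P x.1) (hGx : HasFDerivAt G T x'.1) (hLx : HasFDerivAt L P x'.1) :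
    ‖fderiv ℝ (fun y : E × (F →L[ℝ] ℝ) => (G y.1, L y.1 - y.2.comp ((fun _ : E => T) y.1))) x -
        fderiv ℝ (fun y : E × (F →L[ℝ] ℝ) => (G y.1, L y.1 - y.2.comp ((fun _ : E => T) y.1))) x'‖ ≤
      2 * ‖(fun _ : E => T) x.1 - (fun _ : E => T) x'.1‖ + ‖(fun _ : E => P) x.1 - (fun _ : E => P) x'.1‖ +
        (‖x.2‖ * ‖(fun _ : E => (0 : E →L[ℝ] E →L[ℝ] F)) x.1 - (fun _ : E => (0 : E →L[ℝ] E →L[ℝ] F)) x'.1‖ +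
          ‖x.2 - x'.2‖ * ‖(fun _ : E => (0 : E →L[ℝ] E →L[ℝ] F)) x'.1‖) :=
  norm_fderiv_kktMap_sub_fderiv_kktMap_le (G' := fun _ => T) (G'' := fun _ => (0 : E →L[ℝ] E →L[ℝ] F))
    (L' := fun _ => P) hG (hasFDerivAt_const T x.1) hL hGx (hasFDerivAt_const T x'.1) hLx

end Summit.QuantumFields.BalabanUV.T4Continuum.NE7b.KKTChartDerivativeModulus

end
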